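import Mathlib.Topology.Algebra.InfiniteSum.Basic
import Mathlib.Analysis.SpecialFunctions.Pow.Real
import Literature.Probability.LatticeModels.CFTData
import HarnessLib

-- provenance: harness21/H21/H21/Prelude/StatMech/ConformalBootstrap.lean @ 1a97641 (interim HEAD d8f2665); M5 mechanical rewrite
/-!
# Conformal blocks, OPE convergence, crossing symmetry, Ising-like CFTs

Trunk: StatMech (prelude item P29 `ConformalBootstrap`, review point R8, tier L; notion
`cft_data_ope`). Builds on `Literature.Prelude.StatMech.CFTData` (`CFTData d`, `IsUnitaryCFTData`,
`crossRatioU`, `crossRatioV`).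

Informal content (conformal bootstrap for four identical scalars `φ` of dimension `Δ_φ`).
* *Conformal blocks* `g_{Δ,ℓ}(u,v)` in `d` dimensions, recorded as a *hypothesis structure*
  `ConformalBlocks d` (a bare family of functions `g Δ ℓ u v`), together with the predicate
  `ConformalBlocks.IsStandard` collecting the formalisable normalisation conditions.
* The *conformal block decomposition* (s-channel OPE `12 → 34`)
  `⟨φ(x₁)φ(x₂)φ(x₃)φ(x₄)⟩ = (x₁₂ x₃₄)^{-2Δ_φ} g(u,v)`, `g(u,v) = ∑_𝒪 λ²_{φφ𝒪} g_{Δ_𝒪,ℓ_𝒪}(u,v)`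
  (`fourPointFromOPE`, `HasConvergentOPE`).
* *Crossing symmetry* `v^{Δ_φ} g(u,v) = u^{Δ_φ} g(v,u)` (`SatisfiesCrossing`).
* The predicate `IsIsingLikeCFT` on 3d CFT data: unitary, `ℤ₂`-symmetric, exactly one relevant
  `ℤ₂`-odd scalar `σ` and exactly one relevant non-identity `ℤ₂`-even scalar `ε`, and every
  scalar four-point function has a convergent, crossing-symmetric block decomposition; the
  fields `σ`, `ε` and their dimensions `Δ_σ`, `Δ_ε` are extracted by `Classical.choose`.

Sources: D. Poland, S. Rychkov, A. Vichi, *The conformal bootstrap*, Rev. Mod. Phys. 91 (2019)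
015002, §III.A–III.C (conformal blocks eq. (40)–(42), block decomposition eq. (43), crossing
equation eq. (44)–(45)) and §V.B (3d Ising: `σ`, `ε` the only relevant scalars);
S. El-Showk, M. Paulos, D. Poland, S. Rychkov, D. Simmons-Duffin, A. Vichi, *Solving the 3D
Ising model with the conformal bootstrap*, Phys. Rev. D 86 (2012) 025022, §§2–3;
F. Kos, D. Poland, D. Simmons-Duffin, A. Vichi, *Precision islands in the Ising and O(N)
models*, JHEP 08 (2016) 036, §1 (`Δ_σ = 0.5181489(10)`, `Δ_ε = 1.412625(10)`);
F. A. Dolan, H. Osborn, Nucl. Phys. B 599 (2001) 459 and B 678 (2004) 491 (blocks as Casimir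
eigenfunctions); D. Pappadopulo, S. Rychkov, J. Espin, R. Rattazzi, *OPE convergence in
conformal field theory*, Phys. Rev. D 86 (2012) 105043.

Mathlib anchors used (searched): `tsum`/`Summable` (`Mathlib.Topology.Algebra.InfiniteSum`),
`Real.rpow`, `ContinuousOn`, `Set.Ioo`, `Function.support` (the OPE spectrum is literally
`Function.support (D.ope i i)`), `ExistsUnique`, `Classical.choose`. Mathlib
has no conformal blocks, OPE, crossing equation or CFT notions (searched `conformalBlock`,
`crossing`, `OPE`, `CFT`, `bootstrap`).

Design choices.
* `ConformalBlocks d` is a hypothesis structure whose only field is the family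
  `g : ℝ → ℕ → ℝ → ℝ → ℝ`, `g Δ ℓ u v = g_{Δ,ℓ}(u,v)`; the dimension `d` is a phantom parameter
  fixing which family is meant. The characterisation of the *standard* blocks (eigenfunctions
  of the quadratic conformal Casimir with eigenvalue `Δ(Δ-d) + ℓ(ℓ+d-2)` and Dolan–Osborn
  boundary behaviour `g_{Δ,ℓ} ~ u^{(Δ-ℓ)/2} × Gegenbauer` as `u → 0`) is NOT formalised in v0:
  `ConformalBlocks.IsStandard` records only the formalisable necessary conditions (identity block
  `g_{0,0} ≡ 1`, joint continuity on the convergence square `crossRatioSquare`, the only region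
  on which the blocks are ever evaluated here) and is consumed by statements as the hypothesis
  "`B` is the standard family". This is documented v0 debt, not a stub.
* Region of validity. `fourPointFromOPE` is a `tsum` (junk value `0` where not summable), so all
  predicates only evaluate it on the open square `(u,v) ∈ (0,1)²` (`crossRatioSquare`). In the
  variables `u = z z̄`, `v = (1-z)(1-z̄)` the square corresponds to independent real
  `z, z̄ ∈ (0,1)` (Euclidean configurations, `z̄ = z*`, realise only the sub-region
  `√u + √v ≥ 1`); on all of it both the s- and the t-channel OPE converge absolutely
  (Pappadopulo–Rychkov–Espin–Rattazzi 2012), it contains the crossing-symmetric point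
  `u = v = 1/4` used by the numerical bootstrap, and it is invariant under `u ↔ v`.
  `HasConvergentOPE` asks the identity normalisation `λ_{φφ𝟙} = 1` (which makes the crossing
  equation inhomogeneous, PRV eq. (43)/(45)), summability on the square, and the block
  decomposition of `D.corr i 4` at every configuration whose cross-ratios lie in the square
  (such configurations are automatically non-coincident: `u, v > 0` forces all six distances to
  be non-zero, given the junk value `x / 0 = 0`). (The architect's sketch quantified crossing
  over all `u, v > 0`; we restrict to the convergence square to avoid asserting identities
  between junk values.)
* Only OPEs `φ × φ` of identical scalars are used (`D.ope i i O`), matching `CFTData.corr i`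
  (correlators of identical scalars). OPE coefficients are real, so `λ² = D.ope i i O ^ 2`.
* `IsIsingLikeCFT` fixes `d = 3` and "relevant" is `PrimarySpectrum.IsRelevant 3` (`Δ < 3`);
  uniqueness is `∃!` over `D.ι`. `sigmaField`/`epsilonField` are functions of a proof of
  `IsIsingLikeCFT B D`.
-/

namespace Literature.Probability.LatticeModels

open scoped Topology

variable {d : ℕ}

/-! ### The convergence square of cross-ratios -/

/-- The open *convergence square* `{(u,v) | 0 < u < 1, 0 < v < 1}` of cross-ratios. Writing
`u = z z̄`, `v = (1 - z)(1 - z̄)`, it corresponds to independent real `z, z̄ ∈ (0,1)` (Euclidean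
configurations realise the sub-region `√u + √v ≥ 1`); on it both the s- and t-channel OPEs
converge, and it contains the crossing-symmetric point `u = v = 1/4`.
(Pappadopulo–Rychkov–Espin–Rattazzi, Phys. Rev. D 86 (2012) 105043, §2;
Poland–Rychkov–Vichi 2019, §III.C.) [cite: PolandRychkovVichi2019, §III.C] -/
def crossRatioSquare : Set (ℝ × ℝ) :=
  Set.Ioo 0 1 ×ˢ Set.Ioo 0 1

/-- Membership in the convergence square. (Poland–Rychkov–Vichi 2019, §III.C.) [cite: PolandRychkovVichi2019, §III.C] -/
@[simp] theorem mem_crossRatioSquare (u v : ℝ) :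
    (u, v) ∈ crossRatioSquare ↔ (0 < u ∧ u < 1) ∧ 0 < v ∧ v < 1 := by
  simp [crossRatioSquare, Set.mem_prod, Set.mem_Ioo]

/-- The convergence square is symmetric under the crossing map `u ↔ v`.
(Poland–Rychkov–Vichi 2019, §III.A, eq. (44).) [cite: PolandRychkovVichi2019, §III.A  eq. (44] -/
theorem mem_crossRatioSquare_swap {u v : ℝ} (h : (u, v) ∈ crossRatioSquare) :
    (v, u) ∈ crossRatioSquare := by
  rw [mem_crossRatioSquare] at h ⊢
  exact ⟨h.2, h.1⟩

/-! ### Conformal blocks (hypothesis structure) -/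

/-- A family of candidate *conformal blocks* in `d` dimensions for four identical external
scalars: `B.g Δ ℓ u v = g_{Δ,ℓ}(u,v)`, the contribution of a primary of dimension `Δ` and spin
`ℓ` (and its descendants) to the four-point function, as a function of the cross-ratios `u, v`.
Hypothesis structure: no axioms are bundled; see `ConformalBlocks.IsStandard`. The parameter `d`
is phantom (it fixes which family of blocks is meant).
(Poland–Rychkov–Vichi, Rev. Mod. Phys. 91 (2019), §III.A, eq. (40)–(43); Dolan–Osborn,
Nucl. Phys. B 599 (2001) 459.) [folklore] -/
structure ConformalBlocks (d : ℕ) where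
  /-- The blocks `g Δ ℓ u v = g_{Δ,ℓ}(u,v)`. -/
  g : ℝ → ℕ → ℝ → ℝ → ℝ

namespace ConformalBlocks

/-- The formalisable normalisation conditions on a family of conformal blocks: the identity
block is `g_{0,0}(u,v) = 1`, and every block `g_{Δ,ℓ}` is jointly continuous in `(u,v)` on the
convergence square `crossRatioSquare` (real `z, z̄ ∈ (0,1)`, away from the cut `z ∈ [1,∞)`,
where the Dolan–Osborn blocks are real-analytic). **v0 caveat:** the defining property of the
standard Dolan–Osborn blocks (eigenfunctions of the quadratic Casimir with eigenvalue
`Δ(Δ - d) + ℓ(ℓ + d - 2)` and boundary behaviour `u^{(Δ-ℓ)/2}` as `u → 0`) is not formalised;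
statements use `IsStandard B` as the documented hypothesis "`B` is the standard family of
`d`-dimensional blocks", of which the present conjunction records necessary conditions only.
(Poland–Rychkov–Vichi 2019, §III.A, eqs. (40)–(42) and text below (43), `g_{0,0} = 1`;
Dolan–Osborn, Nucl. Phys. B 678 (2004) 491, §2.) [cite: PolandRychkovVichi2019, §III.A  eqs. (40] -/
def IsStandard (B : ConformalBlocks d) : Prop :=
  (∀ u v : ℝ, B.g 0 0 u v = 1) ∧
    ∀ (Δ : ℝ) (ℓ : ℕ), ContinuousOn (fun p : ℝ × ℝ => B.g Δ ℓ p.1 p.2) crossRatioSquare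

/-- Standard blocks have identity block `1`. (Poland–Rychkov–Vichi 2019, §III.A.) [cite: PolandRychkovVichi2019, §III.A] -/
theorem IsStandard.g_zero_zero {B : ConformalBlocks d} (h : B.IsStandard) (u v : ℝ) :
    B.g 0 0 u v = 1 :=
  h.1 u v

/-- Standard blocks are continuous on the convergence square.
(Dolan–Osborn, Nucl. Phys. B 678 (2004) 491, §2.) [folklore] -/
theorem IsStandard.continuousOn {B : ConformalBlocks d} (h : B.IsStandard) (Δ : ℝ) (ℓ : ℕ) :
    ContinuousOn (fun p : ℝ × ℝ => B.g Δ ℓ p.1 p.2) crossRatioSquare :=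
  h.2 Δ ℓ

end ConformalBlocks

/-! ### OPE spectrum and the conformal block decomposition -/

/-- The set of primaries `𝒪` appearing in the OPE `𝒪ᵢ × 𝒪ᵢ`, i.e. with `λ_{ii𝒪} ≠ 0`:
the `Function.support` of `D.ope i i` (so Mathlib's `support` API applies).
(Poland–Rychkov–Vichi 2019, §II.E, eq. (37) and §III.A.) [cite: PolandRychkovVichi2019, §II.E  eq. (37] -/
def opeSpectrum (D : CFTData d) (i : D.ι) : Set D.ι :=
  Function.support (D.ope i i)

/-- The OPE spectrum is the support of `λ_{ii·}`. (Poland–Rychkov–Vichi 2019, §II.E.) [cite: PolandRychkovVichi2019, §II.E] -/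
theorem opeSpectrum_eq_support (D : CFTData d) (i : D.ι) :
    opeSpectrum D i = Function.support (D.ope i i) :=
  rfl

/-- Membership in the OPE spectrum. (Poland–Rychkov–Vichi 2019, §II.E.) [cite: PolandRychkovVichi2019, §II.E] -/
@[simp] theorem mem_opeSpectrum (D : CFTData d) (i O : D.ι) :
    O ∈ opeSpectrum D i ↔ D.ope i i O ≠ 0 :=
  Function.mem_support

/-- The `𝒪`-th term `λ²_{ii𝒪} g_{Δ_𝒪,ℓ_𝒪}(u,v)` of the conformal block decomposition of
`⟨𝒪ᵢ𝒪ᵢ𝒪ᵢ𝒪ᵢ⟩`. (Poland–Rychkov–Vichi 2019, §III.A, eq. (43).) [cite: PolandRychkovVichi2019, §III.A  eq. (43] -/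
def opeTerm (B : ConformalBlocks d) (D : CFTData d) (i : D.ι) (u v : ℝ) (O : D.ι) : ℝ :=
  D.ope i i O ^ 2 * B.g (D.Δ O) (D.spin O) u v

/-- Unfolding `opeTerm`. (Poland–Rychkov–Vichi 2019, §III.A, eq. (43).) [cite: PolandRychkovVichi2019, §III.A  eq. (43] -/
@[simp] theorem opeTerm_apply (B : ConformalBlocks d) (D : CFTData d) (i : D.ι) (u v : ℝ)
    (O : D.ι) : opeTerm B D i u v O = D.ope i i O ^ 2 * B.g (D.Δ O) (D.spin O) u v :=
  rfl

/-- Terms outside the OPE spectrum vanish. (Poland–Rychkov–Vichi 2019, §III.A.) [cite: PolandRychkovVichi2019, §III.A] -/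
theorem opeTerm_eq_zero_of_notMem {B : ConformalBlocks d} {D : CFTData d} {i O : D.ι}
    (h : O ∉ opeSpectrum D i) (u v : ℝ) : opeTerm B D i u v O = 0 := by
  simp only [mem_opeSpectrum, ne_eq, not_not] at h
  simp [opeTerm, h]

/-- The stripped four-point function reconstructed from the OPE,
`g(u,v) = ∑_𝒪 λ²_{ii𝒪} g_{Δ_𝒪,ℓ_𝒪}(u,v)` (a `tsum` over the whole spectrum; terms with
`λ_{ii𝒪} = 0` vanish; junk value `0` where the series is not summable). In a genuine CFT
`λ_{ii𝒪} = 0` for odd spin `ℓ_𝒪`, so only even spins contribute; here odd-spin primaries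
contribute with whatever coefficient the data `D` carry.
(Poland–Rychkov–Vichi 2019, §III.A, eq. (43); El-Showk et al., Phys. Rev. D 86 (2012)
025022, eq. (2.3).) [cite: PolandRychkovVichi2019, §III.A  eq. (43] -/
noncomputable def fourPointFromOPE (B : ConformalBlocks d) (D : CFTData d) (i : D.ι)
    (u v : ℝ) : ℝ :=
  ∑' O, opeTerm B D i u v O

/-- Unfolding `fourPointFromOPE`. (Poland–Rychkov–Vichi 2019, §III.A, eq. (43).) [cite: PolandRychkovVichi2019, §III.A  eq. (43] -/
theorem fourPointFromOPE_eq_tsum (B : ConformalBlocks d) (D : CFTData d) (i : D.ι)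
    (u v : ℝ) :
    fourPointFromOPE B D i u v = ∑' O, D.ope i i O ^ 2 * B.g (D.Δ O) (D.spin O) u v :=
  rfl

/-- *Convergent OPE / conformal block decomposition* of the four-point function of the scalar
`𝒪ᵢ`: the identity appears in `𝒪ᵢ × 𝒪ᵢ` with unit coefficient `λ_{ii𝟙} = 1` (the
normalisation making `g(u,v) = 1 + ∑_{𝒪 ≠ 𝟙} λ² g_𝒪`, consistent with the two-point
normalisation of `IsUnitaryCFTData`); on the convergence square the series
`∑_𝒪 λ²_{ii𝒪} g_{Δ_𝒪,ℓ_𝒪}(u,v)` is summable; and for every configuration of four points whose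
cross-ratios lie in the square (such points are automatically pairwise distinct),
`⟨𝒪ᵢ(x₁)𝒪ᵢ(x₂)𝒪ᵢ(x₃)𝒪ᵢ(x₄)⟩ = (x₁₂ x₃₄)^{-2Δᵢ} g(u,v)`.
(Poland–Rychkov–Vichi 2019, §III.A, eqs. (39), (43); El-Showk et al. 2012, eq. (2.3);
Pappadopulo–Rychkov–Espin–Rattazzi 2012, Thm in §2 (absolute convergence for `|z| < 1`).) [cite: PolandRychkovVichi2019, §III.A  eqs. (39] -/
def HasConvergentOPE (B : ConformalBlocks d) (D : CFTData d) (i : D.ι) : Prop :=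
  D.ope i i D.unit = 1 ∧
    (∀ p ∈ crossRatioSquare, Summable (opeTerm B D i p.1 p.2)) ∧
      ∀ x : Fin 4 → EuclideanSpace ℝ (Fin d),
        (crossRatioU x, crossRatioV x) ∈ crossRatioSquare →
          D.corr i 4 x =
            (‖x 0 - x 1‖ * ‖x 2 - x 3‖) ^ (-2 * D.Δ i) *
              fourPointFromOPE B D i (crossRatioU x) (crossRatioV x)

/-- Under a convergent OPE the identity has unit OPE coefficient, `λ_{ii𝟙} = 1`.
(Poland–Rychkov–Vichi 2019, §III.A, eq. (43); El-Showk et al. 2012, eq. (2.3).) [cite: PolandRychkovVichi2019, §III.A  eq. (43] -/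
theorem HasConvergentOPE.ope_unit {B : ConformalBlocks d} {D : CFTData d} {i : D.ι}
    (h : HasConvergentOPE B D i) : D.ope i i D.unit = 1 :=
  h.1

/-- Under a convergent OPE the identity lies in the OPE spectrum.
(Poland–Rychkov–Vichi 2019, §III.A, eq. (43).) [cite: PolandRychkovVichi2019, §III.A  eq. (43] -/
theorem HasConvergentOPE.unit_mem_opeSpectrum {B : ConformalBlocks d} {D : CFTData d}
    {i : D.ι} (h : HasConvergentOPE B D i) : D.unit ∈ opeSpectrum D i := by
  rw [mem_opeSpectrum, h.ope_unit]
  exact one_ne_zero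

/-- A convergent OPE is summable on the square. (Pappadopulo–Rychkov–Espin–Rattazzi 2012, §2.) [cite: PappadopuloRychkovEspinRattazzi2012, §2] -/
theorem HasConvergentOPE.summable {B : ConformalBlocks d} {D : CFTData d} {i : D.ι}
    (h : HasConvergentOPE B D i) {u v : ℝ} (huv : (u, v) ∈ crossRatioSquare) :
    Summable (opeTerm B D i u v) :=
  h.2.1 (u, v) huv

/-- A convergent OPE has the sum `fourPointFromOPE`. (Poland–Rychkov–Vichi 2019, §III.A.) [cite: PolandRychkovVichi2019, §III.A] -/
theorem HasConvergentOPE.hasSum {B : ConformalBlocks d} {D : CFTData d} {i : D.ι}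
    (h : HasConvergentOPE B D i) {u v : ℝ} (huv : (u, v) ∈ crossRatioSquare) :
    HasSum (opeTerm B D i u v) (fourPointFromOPE B D i u v) :=
  (h.summable huv).hasSum

/-- The block decomposition of the four-point function under a convergent OPE.
(Poland–Rychkov–Vichi 2019, §III.A, eqs. (39), (43).) [cite: PolandRychkovVichi2019, §III.A  eqs. (39] -/
theorem HasConvergentOPE.corr_four_eq {B : ConformalBlocks d} {D : CFTData d} {i : D.ι}
    (h : HasConvergentOPE B D i) {x : Fin 4 → EuclideanSpace ℝ (Fin d)}
    (huv : (crossRatioU x, crossRatioV x) ∈ crossRatioSquare) :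
    D.corr i 4 x =
      (‖x 0 - x 1‖ * ‖x 2 - x 3‖) ^ (-2 * D.Δ i) *
        fourPointFromOPE B D i (crossRatioU x) (crossRatioV x) :=
  h.2.2 x huv

/-- Configurations whose cross-ratios lie in the convergence square are non-coincident
(positivity of `u` and `v`, with the junk value `x / 0 = 0`, forces all six distances to be
non-zero). (Poland–Rychkov–Vichi 2019, §II.D, eq. (36).) [cite: PolandRychkovVichi2019, §II.D  eq. (36] -/
theorem nonCoincident_of_mem_crossRatioSquare {x : Fin 4 → EuclideanSpace ℝ (Fin d)}
    (huv : (crossRatioU x, crossRatioV x) ∈ crossRatioSquare) : x ∈ NonCoincident d 4 := by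
  rw [mem_crossRatioSquare] at huv
  obtain ⟨⟨hu, -⟩, hv, -⟩ := huv
  have hu' := hu.ne'
  have hv' := hv.ne'
  simp only [crossRatioU, crossRatioV, ne_eq, div_eq_zero_iff, mul_eq_zero, pow_eq_zero_iff,
    OfNat.ofNat_ne_zero, not_false_eq_true, norm_eq_zero, sub_eq_zero, not_or] at hu' hv'
  obtain ⟨⟨h01, h23⟩, h02, h13⟩ := hu'
  obtain ⟨⟨h03, h12⟩, -, -⟩ := hv'
  intro a b hab
  fin_cases a <;> fin_cases b
  any_goals rfl
  all_goals
    exfalso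
    first
    | exact h01 hab | exact h01 hab.symm | exact h23 hab | exact h23 hab.symm
    | exact h02 hab | exact h02 hab.symm | exact h13 hab | exact h13 hab.symm
    | exact h03 hab | exact h03 hab.symm | exact h12 hab | exact h12 hab.symm

/-! ### Crossing symmetry -/

/-- *Crossing symmetry* of the stripped four-point function of the scalar `𝒪ᵢ` on the
convergence square: `v^{Δᵢ} g(u,v) = u^{Δᵢ} g(v,u)` for all `0 < u, v < 1` (real powers).
(Poland–Rychkov–Vichi 2019, §III.A, eqs. (44)–(45); El-Showk et al. 2012, eq. (2.4).) [cite: PolandRychkovVichi2019, §III.A  eqs. (44] -/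
def SatisfiesCrossing (B : ConformalBlocks d) (D : CFTData d) (i : D.ι) : Prop :=
  ∀ u v : ℝ, (u, v) ∈ crossRatioSquare →
    v ^ D.Δ i * fourPointFromOPE B D i u v = u ^ D.Δ i * fourPointFromOPE B D i v u

/-- The crossing equation in "sum rule" form: `∑_𝒪 λ² (v^{Δᵢ} g_𝒪(u,v) - u^{Δᵢ} g_𝒪(v,u)) = 0`
on the square, given a convergent OPE. (Poland–Rychkov–Vichi 2019, §III.C, eq. (49);
Rattazzi–Rychkov–Tonni–Vichi, JHEP 12 (2008) 031, eq. (5.2).) [cite: PolandRychkovVichi2019, §III.C  eq. (49] -/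
theorem SatisfiesCrossing.tsum_sub_eq_zero {B : ConformalBlocks d} {D : CFTData d} {i : D.ι}
    (hc : SatisfiesCrossing B D i) (hs : HasConvergentOPE B D i) {u v : ℝ}
    (huv : (u, v) ∈ crossRatioSquare) :
    ∑' O, D.ope i i O ^ 2 *
        (v ^ D.Δ i * B.g (D.Δ O) (D.spin O) u v - u ^ D.Δ i * B.g (D.Δ O) (D.spin O) v u) =
      0 := by
  have h1 : Summable fun O => v ^ D.Δ i * opeTerm B D i u v O := (hs.summable huv).mul_left _
  have h2 : Summable fun O => u ^ D.Δ i * opeTerm B D i v u O :=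
    (hs.summable (mem_crossRatioSquare_swap huv)).mul_left _
  have key : (fun O => D.ope i i O ^ 2 *
      (v ^ D.Δ i * B.g (D.Δ O) (D.spin O) u v - u ^ D.Δ i * B.g (D.Δ O) (D.spin O) v u)) =
      fun O => v ^ D.Δ i * opeTerm B D i u v O - u ^ D.Δ i * opeTerm B D i v u O := by
    funext O; simp only [opeTerm]; ring
  rw [key, h1.tsum_sub h2, tsum_mul_left, tsum_mul_left]
  have := hc u v huv
  simp only [fourPointFromOPE] at this
  rw [this, sub_self]

/-! ### Ising-like CFTs in three dimensions -/

/-- The predicate "`D` is the data of an *Ising-like* 3d CFT with blocks `B`": `D` is unitary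
CFT data (`IsUnitaryCFTData`) with a global `ℤ₂` symmetry; there is exactly one relevant
(`PrimarySpectrum.IsRelevant 3`, i.e. `Δ < 3`) `ℤ₂`-odd scalar (`σ`) and exactly one relevant
`ℤ₂`-even scalar other than the identity (`ε`); and the four-point function of every scalar
primary has a convergent, identity-normalised conformal block decomposition
(`HasConvergentOPE`) satisfying crossing symmetry (`SatisfiesCrossing`).
(Poland–Rychkov–Vichi 2019, §V.B (3d Ising CFT: `σ, ε` the only relevant scalars) and
§III.A–C; El-Showk et al., Phys. Rev. D 86 (2012) 025022, §3; Kos–Poland–Simmons-Duffin–Vichi,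
JHEP 08 (2016) 036, §1.) [cite: PolandRychkovVichi2019, §V.B (3d Ising CFT:  σ  ε  the only rele] -/
def IsIsingLikeCFT (B : ConformalBlocks 3) (D : CFTData 3) : Prop :=
  IsUnitaryCFTData D ∧ D.IsZ2Symmetric ∧
    (∃! s : D.ι, D.spin s = 0 ∧ D.z2Odd s = true ∧ D.IsRelevant 3 s) ∧
    (∃! e : D.ι, e ≠ D.unit ∧ D.spin e = 0 ∧ D.z2Odd e = false ∧ D.IsRelevant 3 e) ∧
    ∀ i : D.ι, D.spin i = 0 → HasConvergentOPE B D i ∧ SatisfiesCrossing B D i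

namespace IsIsingLikeCFT

variable {B : ConformalBlocks 3} {D : CFTData 3}

/-- An Ising-like CFT is unitary. (Poland–Rychkov–Vichi 2019, §V.B.) [cite: PolandRychkovVichi2019, §V.B] -/
theorem isUnitaryCFTData (h : IsIsingLikeCFT B D) : IsUnitaryCFTData D := h.1

/-- An Ising-like CFT is `ℤ₂`-symmetric. (Poland–Rychkov–Vichi 2019, §V.B.) [cite: PolandRychkovVichi2019, §V.B] -/
theorem isZ2Symmetric (h : IsIsingLikeCFT B D) : D.IsZ2Symmetric := h.2.1

/-- Scalars of an Ising-like CFT have convergent OPEs. (Poland–Rychkov–Vichi 2019, §III.A.) [cite: PolandRychkovVichi2019, §III.A] -/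
theorem hasConvergentOPE (h : IsIsingLikeCFT B D) {i : D.ι} (hi : D.spin i = 0) :
    HasConvergentOPE B D i :=
  (h.2.2.2.2 i hi).1

/-- Scalars of an Ising-like CFT satisfy crossing. (Poland–Rychkov–Vichi 2019, §III.A.) [cite: PolandRychkovVichi2019, §III.A] -/
theorem satisfiesCrossing (h : IsIsingLikeCFT B D) {i : D.ι} (hi : D.spin i = 0) :
    SatisfiesCrossing B D i :=
  (h.2.2.2.2 i hi).2

/-- The spin field `σ` of an Ising-like CFT: the unique relevant `ℤ₂`-odd scalar
(`Classical.choose`). (Poland–Rychkov–Vichi 2019, §V.B; El-Showk et al. 2012, §3.) [cite: PolandRychkovVichi2019, §V.B] -/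
noncomputable def sigmaField (h : IsIsingLikeCFT B D) : D.ι :=
  Classical.choose h.2.2.1.exists

/-- The energy field `ε` of an Ising-like CFT: the unique relevant non-identity `ℤ₂`-even
scalar (`Classical.choose`). (Poland–Rychkov–Vichi 2019, §V.B; El-Showk et al. 2012, §3.) [cite: PolandRychkovVichi2019, §V.B] -/
noncomputable def epsilonField (h : IsIsingLikeCFT B D) : D.ι :=
  Classical.choose h.2.2.2.1.exists

/-- The scaling dimension `Δ_σ` of the spin field. (Kos–Poland–Simmons-Duffin–Vichi 2016, §1:
`Δ_σ = 0.5181489(10)` for the 3d Ising CFT.) [cite: KosPolandSimmonsDuffinVichi2016, §1:  Δ_σ = 0.5181489(10] -/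
noncomputable def deltaSigma (h : IsIsingLikeCFT B D) : ℝ :=
  D.Δ h.sigmaField

/-- The scaling dimension `Δ_ε` of the energy field. (Kos–Poland–Simmons-Duffin–Vichi 2016, §1:
`Δ_ε = 1.412625(10)` for the 3d Ising CFT.) [cite: KosPolandSimmonsDuffinVichi2016, §1:  Δ_ε = 1.412625(10] -/
noncomputable def deltaEpsilon (h : IsIsingLikeCFT B D) : ℝ :=
  D.Δ h.epsilonField

/-- Defining property of `σ`: a relevant `ℤ₂`-odd scalar. (Poland–Rychkov–Vichi 2019, §V.B.) [cite: PolandRychkovVichi2019, §V.B] -/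
theorem sigmaField_spec (h : IsIsingLikeCFT B D) :
    D.spin h.sigmaField = 0 ∧ D.z2Odd h.sigmaField = true ∧ D.IsRelevant 3 h.sigmaField :=
  Classical.choose_spec h.2.2.1.exists

/-- `σ` is relevant: `Δ_σ < 3`. (Poland–Rychkov–Vichi 2019, §V.B.) [cite: PolandRychkovVichi2019, §V.B] -/
theorem delta_sigmaField_lt (h : IsIsingLikeCFT B D) : D.Δ h.sigmaField < 3 := by
  have := h.sigmaField_spec.2.2
  simp only [PrimarySpectrum.IsRelevant, Nat.cast_ofNat] at this
  exact this

/-- Uniqueness of `σ`: any relevant `ℤ₂`-odd scalar is `σ`. (Poland–Rychkov–Vichi 2019, §V.B.) [cite: PolandRychkovVichi2019, §V.B] -/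
theorem eq_sigmaField (h : IsIsingLikeCFT B D) {s : D.ι} (hs : D.spin s = 0)
    (hodd : D.z2Odd s = true) (hrel : D.IsRelevant 3 s) : s = h.sigmaField :=
  h.2.2.1.unique ⟨hs, hodd, hrel⟩ h.sigmaField_spec

/-- Defining property of `ε`: a relevant non-identity `ℤ₂`-even scalar.
(Poland–Rychkov–Vichi 2019, §V.B.) [cite: PolandRychkovVichi2019, §V.B] -/
theorem epsilonField_spec (h : IsIsingLikeCFT B D) :
    h.epsilonField ≠ D.unit ∧ D.spin h.epsilonField = 0 ∧ D.z2Odd h.epsilonField = false ∧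
      D.IsRelevant 3 h.epsilonField :=
  Classical.choose_spec h.2.2.2.1.exists

/-- `ε` is relevant: `Δ_ε < 3`. (Poland–Rychkov–Vichi 2019, §V.B.) [cite: PolandRychkovVichi2019, §V.B] -/
theorem delta_epsilonField_lt (h : IsIsingLikeCFT B D) : D.Δ h.epsilonField < 3 := by
  have := h.epsilonField_spec.2.2.2
  simp only [PrimarySpectrum.IsRelevant, Nat.cast_ofNat] at this
  exact this

/-- Uniqueness of `ε`: any relevant non-identity `ℤ₂`-even scalar is `ε`.
(Poland–Rychkov–Vichi 2019, §V.B.) [cite: PolandRychkovVichi2019, §V.B] -/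
theorem eq_epsilonField (h : IsIsingLikeCFT B D) {e : D.ι} (hne : e ≠ D.unit)
    (he : D.spin e = 0) (heven : D.z2Odd e = false) (hrel : D.IsRelevant 3 e) :
    e = h.epsilonField :=
  h.2.2.2.1.unique ⟨hne, he, heven, hrel⟩ h.epsilonField_spec

/-- In an Ising-like CFT every scalar has `λ_{ii𝟙} = 1`. (Poland–Rychkov–Vichi 2019, §III.A,
eq. (43).) [cite: PolandRychkovVichi2019, §III.A  eq. (43] -/
theorem ope_unit (h : IsIsingLikeCFT B D) {i : D.ι} (hi : D.spin i = 0) :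
    D.ope i i D.unit = 1 :=
  (h.hasConvergentOPE hi).ope_unit

/-- `σ` is not the identity (it is `ℤ₂`-odd, the identity is even in a well-formed spectrum).
(Poland–Rychkov–Vichi 2019, §V.B.) [cite: PolandRychkovVichi2019, §V.B] -/
theorem sigmaField_ne_unit (h : IsIsingLikeCFT B D) : h.sigmaField ≠ D.unit := by
  intro hsu
  have hodd := h.sigmaField_spec.2.1
  rw [hsu, h.isUnitaryCFTData.isWellFormed.2.2.1] at hodd
  exact Bool.false_ne_true hodd

/-- `σ ≠ ε` (opposite `ℤ₂` charges). (Poland–Rychkov–Vichi 2019, §V.B.) [cite: PolandRychkovVichi2019, §V.B] -/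
theorem sigmaField_ne_epsilonField (h : IsIsingLikeCFT B D) : h.sigmaField ≠ h.epsilonField := by
  intro hse
  have hodd := h.sigmaField_spec.2.1
  rw [hse, h.epsilonField_spec.2.2.1] at hodd
  exact Bool.false_ne_true hodd

/-- `0 < Δ_σ < 3`; moreover `Δ_σ ≥ 1/2` by the unitarity bound.
(Poland–Rychkov–Vichi 2019, §II.C eq. (19) and §V.B.) [cite: PolandRychkovVichi2019, §II.C eq. (19] -/
theorem deltaSigma_mem_Ico (h : IsIsingLikeCFT B D) : h.deltaSigma ∈ Set.Ico (1 / 2 : ℝ) 3 := by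
  refine ⟨?_, h.delta_sigmaField_lt⟩
  have hb := (h.isUnitaryCFTData.satisfiesUnitarityBounds h.sigmaField h.sigmaField_ne_unit).1
    h.sigmaField_spec.1
  simp only [deltaSigma]
  norm_num at hb
  linarith

/-- `1/2 ≤ Δ_ε < 3` by the unitarity bound and relevance.
(Poland–Rychkov–Vichi 2019, §II.C eq. (19) and §V.B.) [cite: PolandRychkovVichi2019, §II.C eq. (19] -/
theorem deltaEpsilon_mem_Ico (h : IsIsingLikeCFT B D) :
    h.deltaEpsilon ∈ Set.Ico (1 / 2 : ℝ) 3 := by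
  refine ⟨?_, h.delta_epsilonField_lt⟩
  have hb := (h.isUnitaryCFTData.satisfiesUnitarityBounds h.epsilonField
    h.epsilonField_spec.1).1 h.epsilonField_spec.2.1
  simp only [deltaEpsilon]
  norm_num at hb
  linarith

/-- The four-point function of `σ` satisfies crossing. (El-Showk et al. 2012, §3, eq. (3.1).) [cite: ElShowkEtAl2012, §3  eq. (3.1] -/
theorem satisfiesCrossing_sigmaField (h : IsIsingLikeCFT B D) :
    SatisfiesCrossing B D h.sigmaField :=
  h.satisfiesCrossing h.sigmaField_spec.1

end IsIsingLikeCFT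

end Literature.Probability.LatticeModels
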